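import Summits.QuantumFields.QCD.Theorems.HeatSlicedQuarksQuarkLoopCoefficientFreeHeatCalculusAuxD
import Summits.QuantumFields.QCD.Theorems.HeatSlicedQuarksQuarkLoopCoefficientFreeHeatCalculusAuxE
import Summits.QuantumFields.QCD.Theorems.HeatSlicedQuarksQuarkLoopCoefficientFreeMajorantToolkitAux
import Summits.QuantumFields.QCD.Theorems.HeatSlicedQuarksQuarkLoopCoefficientSecondOrderExpansionAux

/-!
# Free heat calculus on `ℤ⁴`, part F: the semigroup law and the IBP identity of the free kernel
(line `Sketch` of crux stmt-QuantumFields-16786, helper file of the stub `stub_freeHeatCalculus`)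

* Conjunct (5) of `FreeHeatCalculus`: `Σ_y k_s(y) k_r(w − y) = k_{s+r}(w)` for `s, r ≥ 0`, as a `HasSum`.
For fixed `s ≥ 0` both `r ↦ (w ↦ Σ_y k_s(y) k_r(w − y))` and `r ↦ k_{s+r}` solve the lattice heat equation
`∂_r X = −ĥ ∗ X` (the series is differentiated termwise: its terms are dominated by `|k_s(y)| e^{68|r|}`,
summable by the Gaussian majorant and the mass bound of the toolkit), have the same initial value `k_s`
(`k_0 = δ₀`) and are bounded; uniqueness (`lattice_heat_unique` of part E) identifies them.
* Conjunct (6), the first-order integration-by-parts identity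
  `t Σ_z z_ν ĥ(z) k_t(w − z) + w_ν k_t(w) = 0` for `t ≥ 0`: the left side solves the lattice heat equation
  with zero initial value and is bounded on compact time intervals (the bound of `w_ν k_t(w)` is where the
  Gaussian majorant and the moment bound of the toolkit enter), hence vanishes by uniqueness.
-/

noncomputable section

namespace Summit.QuantumFields.QCD.Cruxes.QuarkLoopCoefficient.Sketch.FreeHeatCalculus

open Literature.MathematicalPhysics.QuantumLattice Literature.MathematicalPhysics.QuantumFieldTheory
open Literature.Probability.LatticeModels (Site)
open Summit.QuantumFields.QCD.Theorems.QuarkLoopCoefficient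
open Summit.QuantumFields.QCD.Cruxes.QuarkLoopCoefficient.Sketch.HeatSeries
open MeasureTheory
open scoped Matrix ComplexConjugate
-- Euclidean-length and Gaussian-profile basics reused from the landed toolkit / expansion helpers.
open Summit.QuantumFields.QCD.Cruxes.QuarkLoopCoefficient.Sketch.FreeMajorantToolkit
  (elen_nonneg elen_zero abs_apply_le_elen)
open Summit.QuantumFields.QCD.Cruxes.QuarkLoopCoefficient.Sketch.SecondOrderExpansion (gaussProfile_le_one)

/-- Summability of `y ↦ |k_s(y)|` from the Gaussian majorant and the mass bound. -/
theorem summable_abs_freeKer {C c s : ℝ}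
    (hk : ∀ t : ℝ, 0 ≤ t → ∀ w : Site 4, |freeKer t w| ≤ C * gaussProfile c t w)
    (hmass : ∀ t : ℝ, 0 ≤ t → Summable (fun y : Site 4 => gaussProfile c t y)) (hs : 0 ≤ s) :
    Summable fun y : Site 4 => |freeKer s y| :=
  Summable.of_nonneg_of_le (fun _ => abs_nonneg _) (hk s hs) ((hmass s hs).mul_left C)

/-- The terms of the convolution series are dominated by `|k_s(y)| e^{68|r|}`. -/
theorem abs_conv_term_le (s r : ℝ) (w y : Site 4) :
    |freeKer s y * freeKer r (w - y)| ≤ |freeKer s y| * Real.exp (68 * |r|) := by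
  rw [abs_mul]
  exact mul_le_mul_of_nonneg_left (abs_freeKer_le r _) (abs_nonneg _)

/-- Summability of the convolution series `y ↦ k_s(y) k_r(w − y)` (any real `r`). -/
theorem summable_conv {s : ℝ} (hsum : Summable fun y : Site 4 => |freeKer s y|) (r : ℝ) (w : Site 4) :
    Summable fun y : Site 4 => freeKer s y * freeKer r (w - y) :=
  Summable.of_norm_bounded (hsum.mul_right (Real.exp (68 * |r|))) fun y =>
    (Real.norm_eq_abs _).le.trans (abs_conv_term_le s r w y)

/-- The convolution series at `r = 0` collapses to `k_s(w)` (`k_0 = δ₀`). -/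
theorem tsum_conv_zero (s : ℝ) (w : Site 4) : ∑' y : Site 4, freeKer s y * freeKer 0 (w - y) = freeKer s w := by
  rw [tsum_eq_single w]
  · rw [freeKer_zero, sub_self, if_pos rfl, mul_one]
  · intro y hy
    rw [freeKer_zero, if_neg (sub_ne_zero.mpr (Ne.symm hy)), mul_zero]

/-- Bound of the convolution series for `r ≥ 0`: `|Σ_y k_s(y) k_r(w − y)| ≤ Σ_y |k_s(y)|`. -/
theorem abs_tsum_conv_le {s r : ℝ} (hsum : Summable fun y : Site 4 => |freeKer s y|) (hr : 0 ≤ r)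
    (w : Site 4) : |∑' y : Site 4, freeKer s y * freeKer r (w - y)| ≤ ∑' y : Site 4, |freeKer s y| := by
  have h1 : ∀ y : Site 4, ‖freeKer s y * freeKer r (w - y)‖ ≤ |freeKer s y| := fun y => by
    rw [Real.norm_eq_abs, abs_mul]
    calc |freeKer s y| * |freeKer r (w - y)| ≤ |freeKer s y| * 1 :=
          mul_le_mul_of_nonneg_left (abs_freeKer_le_one hr _) (abs_nonneg _)
      _ = |freeKer s y| := mul_one _
  rw [← Real.norm_eq_abs]
  exact tsum_of_norm_bounded hsum.hasSum h1

/-- Termwise differentiation of the convolution series in `r`: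
`∂_r Σ_y k_s(y) k_r(w − y) = −Σ_{z ∈ nbr2 0} ĥ(z) Σ_y k_s(y) k_r(w − z − y)`. -/
theorem hasDerivAt_tsum_conv {s : ℝ} (hsum : Summable fun y : Site 4 => |freeKer s y|) (R : ℝ) {r : ℝ}
    (hr : r ∈ Set.Ioo (-(R + 1)) (R + 1)) (w : Site 4) :
    HasDerivAt (fun r : ℝ => ∑' y : Site 4, freeKer s y * freeKer r (w - y))
      (-(∑ z ∈ nbr2 0, hhat z • ∑' y : Site 4, freeKer s y * freeKer r (w - z - y))) r := by
  set K : ℝ := ∑ z ∈ nbr2 0, |hhat z| with hK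
  have hK0 : 0 ≤ K := Finset.sum_nonneg fun z _ => abs_nonneg _
  -- termwise derivatives and their uniform bound on the time interval
  have hf : ∀ (y : Site 4) (r' : ℝ), r' ∈ Set.Ioo (-(R + 1)) (R + 1) →
      HasDerivAt (fun r : ℝ => freeKer s y * freeKer r (w - y))
        (freeKer s y * -(∑ z ∈ nbr2 0, hhat z * freeKer r' (w - y - z))) r' :=
    fun y r' _ => (hasDerivAt_freeKer r' (w - y)).const_mul _
  have hf' : ∀ (y : Site 4) (r' : ℝ), r' ∈ Set.Ioo (-(R + 1)) (R + 1) →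
      ‖freeKer s y * -(∑ z ∈ nbr2 0, hhat z * freeKer r' (w - y - z))‖ ≤
        |freeKer s y| * (K * Real.exp (68 * (R + 1))) := by
    intro y r' hr'
    rw [Real.norm_eq_abs, abs_mul, abs_neg]
    refine mul_le_mul_of_nonneg_left ?_ (abs_nonneg _)
    have habs : |r'| ≤ R + 1 := abs_le.mpr ⟨hr'.1.le, hr'.2.le⟩
    calc |∑ z ∈ nbr2 0, hhat z * freeKer r' (w - y - z)|
        ≤ ∑ z ∈ nbr2 0, |hhat z * freeKer r' (w - y - z)| := Finset.abs_sum_le_sum_abs _ _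
      _ ≤ ∑ z ∈ nbr2 0, |hhat z| * Real.exp (68 * (R + 1)) := Finset.sum_le_sum fun z _ => by
          rw [abs_mul]
          refine mul_le_mul_of_nonneg_left ((abs_freeKer_le r' _).trans ?_) (abs_nonneg _)
          exact Real.exp_le_exp.mpr (by nlinarith)
      _ = K * Real.exp (68 * (R + 1)) := by rw [← Finset.sum_mul]
  have h0mem : (0 : ℝ) ∈ Set.Ioo (-(R + 1)) (R + 1) := by
    constructor <;> nlinarith [hr.1, hr.2]
  have key := hasDerivAt_tsum_of_isPreconnected (hsum.mul_right (K * Real.exp (68 * (R + 1))))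
    isOpen_Ioo isPreconnected_Ioo hf hf' h0mem (summable_conv hsum 0 w) hr
  refine key.congr_deriv ?_
  -- exchange the series with the finite stencil sum
  have hsm : ∀ z ∈ nbr2 0, Summable fun y : Site 4 =>
      -(hhat z * (freeKer s y * freeKer r (w - z - y))) := fun z _ =>
    ((summable_conv hsum r (w - z)).mul_left (hhat z)).neg
  calc ∑' y : Site 4, freeKer s y * -(∑ z ∈ nbr2 0, hhat z * freeKer r (w - y - z))
      = ∑' y : Site 4, ∑ z ∈ nbr2 0, -(hhat z * (freeKer s y * freeKer r (w - z - y))) := by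
        refine tsum_congr fun y => ?_
        rw [mul_neg, Finset.mul_sum, ← Finset.sum_neg_distrib]
        refine Finset.sum_congr rfl fun z _ => ?_
        rw [sub_right_comm]
        ring
    _ = ∑ z ∈ nbr2 0, ∑' y : Site 4, -(hhat z * (freeKer s y * freeKer r (w - z - y))) :=
        Summable.tsum_finsetSum hsm
    _ = -(∑ z ∈ nbr2 0, hhat z • ∑' y : Site 4, freeKer s y * freeKer r (w - z - y)) := by
        rw [← Finset.sum_neg_distrib]
        refine Finset.sum_congr rfl fun z _ => ?_
        rw [tsum_neg, tsum_mul_left, smul_eq_mul]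

/-- **The semigroup law** (conjunct (5) of `FreeHeatCalculus`): for `s, r ≥ 0`,
`Σ_y k_s(y) k_r(w − y) = k_{s+r}(w)` as a `HasSum`. -/
theorem semigroup_identity
    (hgauss : ∃ C c : ℝ, 0 < c ∧ ∀ t : ℝ, 0 ≤ t → ∀ w : Site 4, |freeKer t w| ≤ C * gaussProfile c t w)
    (hmass : ∀ c : ℝ, 0 < c → ∃ A : ℝ, ∀ t : ℝ, 0 ≤ t →
      Summable (fun y : Site 4 => gaussProfile c t y) ∧ ∑' y : Site 4, gaussProfile c t y ≤ A) :
    ∀ s r : ℝ, 0 ≤ s → 0 ≤ r → ∀ w : Site 4,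
      HasSum (fun y : Site 4 => freeKer s y * freeKer r (w - y)) (freeKer (s + r) w) := by
  obtain ⟨C, c, hc, hk⟩ := hgauss
  obtain ⟨A, hA⟩ := hmass c hc
  intro s R hs hR w₀
  have hsum : Summable fun y : Site 4 => |freeKer s y| := summable_abs_freeKer hk (fun t ht => (hA t ht).1) hs
  -- the difference of the two candidate solutions
  set X : ℝ → Site 4 → ℝ := fun r w =>
    (∑' y : Site 4, freeKer s y * freeKer r (w - y)) - freeKer (s + r) w with hX
  have h0 : ∀ w : Site 4, X 0 w = 0 := fun w => by
    simp only [hX, tsum_conv_zero, add_zero, sub_self]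
  have hbound : ∀ r ∈ Set.Icc 0 R, ∀ w : Site 4, ‖X r w‖ ≤ (∑' y : Site 4, |freeKer s y|) + 1 := by
    intro r hr w
    rw [Real.norm_eq_abs, hX]
    refine (abs_sub _ _).trans (add_le_add (abs_tsum_conv_le hsum hr.1 w) ?_)
    exact abs_freeKer_le_one (by linarith [hr.1]) w
  have hderiv : ∀ r ∈ Set.Icc 0 R, ∀ w : Site 4,
      HasDerivAt (fun r' => X r' w) (-(∑ z ∈ nbr2 0, hhat z • X r (w - z))) r := by
    intro r hr w
    have hr' : r ∈ Set.Ioo (-(R + 1)) (R + 1) := ⟨by linarith [hr.1], by linarith [hr.2]⟩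
    have hAd := hasDerivAt_tsum_conv hsum R hr' w
    have hBd : HasDerivAt (fun r' : ℝ => freeKer (s + r') w)
        (-(∑ z ∈ nbr2 0, hhat z * freeKer (s + r) (w - z))) r :=
      (hasDerivAt_freeKer (s + r) w).comp_const_add s r
    refine (hAd.sub hBd).congr_deriv ?_
    simp only [hX, smul_eq_mul, mul_sub, Finset.sum_sub_distrib]
    ring
  have hzero := lattice_heat_unique hderiv hbound h0 R ⟨hR, le_rfl⟩ w₀
  simp only [hX, sub_eq_zero] at hzero
  rw [← hzero]
  exact (summable_conv hsum R w₀).hasSum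

/-! ## Elementary facts about the Gaussian profile -/

/-- The Gaussian profile is positive. -/
theorem gaussProfile_pos (c t : ℝ) (ht : 0 ≤ t) (w : Site 4) : 0 < gaussProfile c t w := by
  unfold gaussProfile
  positivity

/-- The Gaussian profile at the space-time origin equals one. -/
theorem gaussProfile_zero_zero (c : ℝ) : gaussProfile c 0 0 = 1 := by
  simp [gaussProfile, elen_zero]

/-! ## The first-order integration-by-parts identity -/

/-- The initial value of the IBP combination vanishes: `0 · (…) + w_ν k_0(w) = 0`. -/
theorem ibp_zero (w : Site 4) (ν : Fin 4) :
    0 * (∑ z ∈ nbr2 0, ((z ν : ℤ) : ℝ) * hhat z * freeKer 0 (w - z)) + ((w ν : ℤ) : ℝ) * freeKer 0 w = 0 := by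
  rw [zero_mul, zero_add, freeKer_zero]
  split_ifs with h
  · rw [h]; simp
  · rw [mul_zero]

/-- The IBP combination solves the lattice heat equation (pure finite algebra on top of the heat
equation of the free kernel). -/
theorem hasDerivAt_ibp (t : ℝ) (w : Site 4) (ν : Fin 4) :
    HasDerivAt (fun s : ℝ =>
        s * (∑ z ∈ nbr2 0, ((z ν : ℤ) : ℝ) * hhat z * freeKer s (w - z)) + ((w ν : ℤ) : ℝ) * freeKer s w)
      (-(∑ z ∈ nbr2 0, hhat z • (t * (∑ z' ∈ nbr2 0, ((z' ν : ℤ) : ℝ) * hhat z' * freeKer t (w - z - z')) +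
        (((w - z) ν : ℤ) : ℝ) * freeKer t (w - z)))) t := by
  -- the derivative of the finite sum `S_s(w) = Σ_z z_ν ĥ(z) k_s(w − z)`
  have hS : HasDerivAt (fun s : ℝ => ∑ z ∈ nbr2 0, ((z ν : ℤ) : ℝ) * hhat z * freeKer s (w - z))
      (∑ z ∈ nbr2 0, ((z ν : ℤ) : ℝ) * hhat z *
        -(∑ z' ∈ nbr2 0, hhat z' * freeKer t (w - z - z'))) t :=
    HasDerivAt.fun_sum fun z _ => (hasDerivAt_freeKer t (w - z)).const_mul _
  have h1 := (hasDerivAt_id t).mul hS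
  have h2 := (hasDerivAt_freeKer t w).const_mul (((w ν : ℤ) : ℝ))
  have h := h1.add h2
  refine h.congr_deriv ?_
  -- algebra: with `P = Σ_z z_ν ĥ(z) k(w−z)`, `Q = Σ_a ĥ(a) Σ_b b_ν ĥ(b) k(w−a−b)`, `R = Σ_z ĥ(z) k(w−z)`
  -- both sides equal `P − t Q − w_ν R`
  have hswap : ∑ z ∈ nbr2 0, ((z ν : ℤ) : ℝ) * hhat z * -(∑ z' ∈ nbr2 0, hhat z' * freeKer t (w - z - z')) =
      -(∑ a ∈ nbr2 0, hhat a * ∑ b ∈ nbr2 0, ((b ν : ℤ) : ℝ) * hhat b * freeKer t (w - a - b)) := by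
    simp only [mul_neg, Finset.sum_neg_distrib, Finset.mul_sum]
    rw [Finset.sum_comm]
    refine congrArg Neg.neg (Finset.sum_congr rfl fun a _ => Finset.sum_congr rfl fun b _ => ?_)
    rw [sub_right_comm]
    ring
  have hR : ∑ z ∈ nbr2 0, hhat z • (t * (∑ z' ∈ nbr2 0, ((z' ν : ℤ) : ℝ) * hhat z' * freeKer t (w - z - z')) +
        (((w - z) ν : ℤ) : ℝ) * freeKer t (w - z)) =
      t * (∑ a ∈ nbr2 0, hhat a * ∑ b ∈ nbr2 0, ((b ν : ℤ) : ℝ) * hhat b * freeKer t (w - a - b)) +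
        ((w ν : ℤ) : ℝ) * (∑ z ∈ nbr2 0, hhat z * freeKer t (w - z)) -
        ∑ z ∈ nbr2 0, ((z ν : ℤ) : ℝ) * hhat z * freeKer t (w - z) := by
    simp only [smul_eq_mul, Pi.sub_apply, Int.cast_sub]
    rw [Finset.mul_sum, Finset.mul_sum, ← Finset.sum_add_distrib, ← Finset.sum_sub_distrib]
    refine Finset.sum_congr rfl fun z _ => ?_
    ring
  rw [hswap, hR]
  simp only [id]
  ring

/-- **The first-order IBP identity** (conjunct (6) of `FreeHeatCalculus`), from the Gaussian majorant,
the moment bound (`j = 1`) and the initial value / heat equation of the free kernel, by uniqueness. -/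
theorem ibp_identity
    (hgauss : ∃ C c : ℝ, 0 < c ∧ ∀ t : ℝ, 0 ≤ t → ∀ w : Site 4, |freeKer t w| ≤ C * gaussProfile c t w)
    (hmom : ∀ c ε : ℝ, 0 < c → 0 < ε → ε < 1 → ∀ j : ℕ, ∃ A : ℝ, ∀ t : ℝ, 0 ≤ t → ∀ w : Site 4,
      elen w ^ j * gaussProfile c t w ≤ A * Real.sqrt (1 + t) ^ j * gaussProfile ((1 - ε) * c) t w) :
    ∀ t : ℝ, 0 ≤ t → ∀ (w : Site 4) (ν : Fin 4),
      t * (∑ z ∈ nbr2 0, ((z ν : ℤ) : ℝ) * hhat z * freeKer t (w - z)) + ((w ν : ℤ) : ℝ) * freeKer t w = 0 := by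
  obtain ⟨C, c, hc, hk⟩ := hgauss
  obtain ⟨A, hA⟩ := hmom c (1 / 2) hc (by norm_num) (by norm_num) 1
  -- signs of the constants
  have hC : 0 ≤ C := by
    have h := hk 0 le_rfl 0
    rw [gaussProfile_zero_zero, mul_one] at h
    exact (abs_nonneg _).trans h
  have hA0 : 0 ≤ A := by
    have h := hA 0 le_rfl 0
    rw [elen_zero, gaussProfile_zero_zero, gaussProfile_zero_zero] at h
    simpa using h
  intro T hT w₀ ν
  -- the IBP combination as a function of `(s, w)`
  set X : ℝ → Site 4 → ℝ := fun s w =>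
    s * (∑ z ∈ nbr2 0, ((z ν : ℤ) : ℝ) * hhat z * freeKer s (w - z)) + ((w ν : ℤ) : ℝ) * freeKer s w with hX
  -- uniform bound on `[0, T]`
  set B : ℝ := T * (∑ z ∈ nbr2 0, |((z ν : ℤ) : ℝ)| * |hhat z|) + C * A * Real.sqrt (1 + T) with hB
  have hbound : ∀ s ∈ Set.Icc 0 T, ∀ w : Site 4, ‖X s w‖ ≤ B := by
    intro s hs w
    have hs0 : 0 ≤ s := hs.1
    rw [Real.norm_eq_abs, hX]
    refine (abs_add_le _ _).trans (add_le_add ?_ ?_)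
    · rw [abs_mul, abs_of_nonneg hs0]
      refine mul_le_mul hs.2 ?_ (abs_nonneg _) hT
      refine (Finset.abs_sum_le_sum_abs _ _).trans (Finset.sum_le_sum fun z _ => ?_)
      rw [abs_mul, abs_mul]
      calc |((z ν : ℤ) : ℝ)| * |hhat z| * |freeKer s (w - z)| ≤ |((z ν : ℤ) : ℝ)| * |hhat z| * 1 :=
            mul_le_mul_of_nonneg_left (abs_freeKer_le_one hs0 _) (by positivity)
        _ = |((z ν : ℤ) : ℝ)| * |hhat z| := mul_one _
    · rw [abs_mul]
      have h1 : |((w ν : ℤ) : ℝ)| * |freeKer s w| ≤ elen w * (C * gaussProfile c s w) :=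
        mul_le_mul (abs_apply_le_elen w ν) (hk s hs0 w) (abs_nonneg _) (elen_nonneg w)
      have h2 : elen w * gaussProfile c s w ≤ A * Real.sqrt (1 + s) * gaussProfile ((1 - 1 / 2) * c) s w := by
        simpa using hA s hs0 w
      have h3 : gaussProfile ((1 - 1 / 2) * c) s w ≤ 1 := gaussProfile_le_one (by positivity) hs0 w
      have h4 : Real.sqrt (1 + s) ≤ Real.sqrt (1 + T) := Real.sqrt_le_sqrt (by linarith [hs.2])
      calc |((w ν : ℤ) : ℝ)| * |freeKer s w| ≤ elen w * (C * gaussProfile c s w) := h1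
        _ = C * (elen w * gaussProfile c s w) := by ring
        _ ≤ C * (A * Real.sqrt (1 + s) * gaussProfile ((1 - 1 / 2) * c) s w) := mul_le_mul_of_nonneg_left h2 hC
        _ ≤ C * (A * Real.sqrt (1 + T) * 1) := by
            refine mul_le_mul_of_nonneg_left ?_ hC
            exact mul_le_mul (mul_le_mul_of_nonneg_left h4 hA0) h3 (gaussProfile_pos _ _ hs0 _).le
              (by positivity)
        _ = C * A * Real.sqrt (1 + T) := by ring
  -- the heat equation for `X`
  have hderiv : ∀ s ∈ Set.Icc 0 T, ∀ w : Site 4,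
      HasDerivAt (fun r => X r w) (-(∑ z ∈ nbr2 0, hhat z • X s (w - z))) s := by
    intro s _ w
    exact hasDerivAt_ibp s w ν
  have h0 : ∀ w : Site 4, X 0 w = 0 := fun w => ibp_zero w ν
  exact lattice_heat_unique hderiv hbound h0 T ⟨hT, le_rfl⟩ w₀

/-! ## Registered headline -/

/-- Registered headline of this helper file (aux stub `stub_freeHeatCalculusAuxF` of crux
stmt-QuantumFields-16786, line `Sketch`): the semigroup law of the free kernel from the Gaussian
majorant and the mass bound. -/
theorem stub_freeHeatCalculusAuxF :
    (∃ C c : ℝ, 0 < c ∧ ∀ t : ℝ, 0 ≤ t → ∀ w : Site 4, |freeKer t w| ≤ C * gaussProfile c t w) →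
    (∀ c : ℝ, 0 < c → ∃ A : ℝ, ∀ t : ℝ, 0 ≤ t →
      Summable (fun y : Site 4 => gaussProfile c t y) ∧ ∑' y : Site 4, gaussProfile c t y ≤ A) →
    ∀ s r : ℝ, 0 ≤ s → 0 ≤ r → ∀ w : Site 4,
      HasSum (fun y : Site 4 => freeKer s y * freeKer r (w - y)) (freeKer (s + r) w) :=
  semigroup_identity

end Summit.QuantumFields.QCD.Cruxes.QuarkLoopCoefficient.Sketch.FreeHeatCalculus

end
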